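import Summits.BirchSwinnertonDyer.BirchSwinnertonDyer.Theorems.ResidualThetaTransportAtTwoThetaLayerLambdaCongruenceAtTwoCurveEulerHecke
import HarnessLib

/-!
# Crux `ThetaLayerLambdaCongruenceAtTwo` (stmt-BirchSwinnertonDyer-20688, route ResidualThetaTransportAtTwo), line
# `birth`: the curve-side `T_q`-relation with eigenvalue `W.frobeniusTrace q` (the W-package shape consumed by the lead's
# (C3)/PlusLineGlue) (width prover bsd-wall-rtt-p3-w2 g0; `--supports stmt-BirchSwinnertonDyer-20688 --as helper`; closes nothing)

HONEST FRAMING. THEOREMS only; nothing about any curve or form is asserted beyond the hypotheses; BSD is not proved by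
any of this.

WHAT. For an admissible `S₀` (it contains every bad place of `W`), a prime `q` not among the `ℓ_v` is GOOD for `W`, so
`a_q(W) = W.LFunction q = W.frobeniusTrace q` (`LFunction_apply_prime_eq_frobeniusTrace`) and `q ∤ N_W`
(`dvd_conductorNorm_iff`); hence the exact relation of `heckeT_depletedCurveSymbol_localPolynomialAt` reads
`(W.frobeniusTrace q)·φ^{S₀}_W(r) = ∑_{j<q} φ^{S₀}_W((r+j)/q) + φ^{S₀}_W(q r)` — `T_q φ^{S₀}_W = a_q(W) φ^{S₀}_W` EXACTLY,
in the shape `(T)` of the lead's plus-line stub (C3) (before scaling by the primitive constant of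
`exists_primitive_scaling_depletedCurveSymbol`). [GreenbergVatsal2000 §1 (8), §3]
-/

noncomputable section

-- justification: the `Summit.BirchSwinnertonDyer.BirchSwinnertonDyer.…` path repeats a component (route-file convention)
set_option linter.dupNamespace false

open scoped Classical

open Polynomial

open Literature.NumberTheory.EllipticCurves Literature.NumberTheory.EllipticCurves.ModularForms

namespace Summit.BirchSwinnertonDyer.BirchSwinnertonDyer.Theorems.ThetaLayerLambdaCongruenceAtTwo

section Curve

variable {W : WeierstrassCurve ℚ} [W.IsElliptic] [W.IsGloballyMinimal]

/-- **Off an admissible `S₀` every prime is good: `a_q(W) = W.LFunction q = W.frobeniusTrace q` and `q ∤ N_W`.**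
[cite: SilvermanAEC2009, Exercise 8.19(a) and §C.16] -/
theorem lFunction_eq_frobeniusTrace_of_forall_ne
    (S₀ : Finset (IsDedekindDomain.HeightOneSpectrum (NumberField.RingOfIntegers ℚ)))
    (hSW : ∀ v : IsDedekindDomain.HeightOneSpectrum (NumberField.RingOfIntegers ℚ), ¬ W.HasGoodReductionAt v → v ∈ S₀)
    {q : ℕ} (hq : q.Prime) (hqS : ∀ v ∈ S₀, Rat.HeightOneSpectrum.natGenerator v ≠ q) :
    W.LFunction q = W.frobeniusTrace q ∧ ¬ q ∣ W.conductorNorm ℤ := by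
  obtain ⟨v, hv⟩ : ∃ v : IsDedekindDomain.HeightOneSpectrum (NumberField.RingOfIntegers ℚ),
      Rat.HeightOneSpectrum.natGenerator v = q :=
    ⟨(Rat.HeightOneSpectrum.primesEquiv (R := NumberField.RingOfIntegers ℚ)).symm ⟨q, hq⟩,
      congrArg Subtype.val ((Rat.HeightOneSpectrum.primesEquiv (R := NumberField.RingOfIntegers ℚ)).apply_symm_apply ⟨q, hq⟩)⟩
  have hgood : W.HasGoodReductionAt v := by
    by_contra h; exact hqS v (hSW v h) hv
  haveI : Fact q.Prime := ⟨hq⟩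
  subst hv
  exact ⟨WeierstrassCurve.LFunction_apply_prime_eq_frobeniusTrace W _
      ((WeierstrassCurve.hasGoodReductionAtPrime_iff_hasGoodReductionAt_ringOfIntegers v W).mpr hgood),
    fun h ↦ ((WeierstrassCurve.dvd_conductorNorm_iff W v).mp h) hgood⟩

variable [NeZero (W.conductorNorm ℤ)] {f : CuspForm (CongruenceSubgroup.Gamma0 (W.conductorNorm ℤ)) 2}

/-- **`T_q φ^{S₀}_W = (W.frobeniusTrace q)·φ^{S₀}_W` EXACTLY, for primes `q` off an admissible `S₀`** — the curve-side
`(T)`-input of the plus-line stub (C3) in the lead's shape: `a_q·φ(r) = ∑_{j<q} φ((r+j)/q) + φ(q r)` with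
`a_q = W.frobeniusTrace q`, `φ = φ^{S₀}_W` the exact depleted rational plus symbol of the crux.
[cite: GreenbergVatsal2000, §1 (8) and §3] -/
theorem heckeT_depletedCurveSymbol_frobeniusTrace (hf : IsNewformOf W f)
    (S₀ : Finset (IsDedekindDomain.HeightOneSpectrum (NumberField.RingOfIntegers ℚ)))
    (hSW : ∀ v : IsDedekindDomain.HeightOneSpectrum (NumberField.RingOfIntegers ℚ), ¬ W.HasGoodReductionAt v → v ∈ S₀)
    {q : ℕ} (hq : q.Prime)
    (hqS : ∀ v ∈ S₀, Rat.HeightOneSpectrum.natGenerator v ≠ q) (r : ℚ) :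
    (W.frobeniusTrace q : PadicAlgCl 2) * (∑ k ∈ Fintype.piFinset (fun _ : S₀ ↦ Finset.range 3),
        (∏ v : S₀, ((W.localPolynomialAt (v : IsDedekindDomain.HeightOneSpectrum (NumberField.RingOfIntegers ℚ))).map (Int.castRingHom (PadicAlgCl 2))).coeff (k v) *
            ((Rat.HeightOneSpectrum.natGenerator (v : IsDedekindDomain.HeightOneSpectrum (NumberField.RingOfIntegers ℚ)) : PadicAlgCl 2)⁻¹) ^ (k v)) *
          algebraMap ℚ (PadicAlgCl 2) (ratPlusSymbol f (r * ((∏ v : S₀, Rat.HeightOneSpectrum.natGenerator (v : IsDedekindDomain.HeightOneSpectrum (NumberField.RingOfIntegers ℚ)) ^ (k v) : ℕ) : ℚ)))) =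
      (∑ j : Fin q, ∑ k ∈ Fintype.piFinset (fun _ : S₀ ↦ Finset.range 3),
        (∏ v : S₀, ((W.localPolynomialAt (v : IsDedekindDomain.HeightOneSpectrum (NumberField.RingOfIntegers ℚ))).map (Int.castRingHom (PadicAlgCl 2))).coeff (k v) *
            ((Rat.HeightOneSpectrum.natGenerator (v : IsDedekindDomain.HeightOneSpectrum (NumberField.RingOfIntegers ℚ)) : PadicAlgCl 2)⁻¹) ^ (k v)) *
          algebraMap ℚ (PadicAlgCl 2) (ratPlusSymbol f ((r + j) / q * ((∏ v : S₀, Rat.HeightOneSpectrum.natGenerator (v : IsDedekindDomain.HeightOneSpectrum (NumberField.RingOfIntegers ℚ)) ^ (k v) : ℕ) : ℚ)))) +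
      ∑ k ∈ Fintype.piFinset (fun _ : S₀ ↦ Finset.range 3),
          (∏ v : S₀, ((W.localPolynomialAt (v : IsDedekindDomain.HeightOneSpectrum (NumberField.RingOfIntegers ℚ))).map (Int.castRingHom (PadicAlgCl 2))).coeff (k v) *
              ((Rat.HeightOneSpectrum.natGenerator (v : IsDedekindDomain.HeightOneSpectrum (NumberField.RingOfIntegers ℚ)) : PadicAlgCl 2)⁻¹) ^ (k v)) *
            algebraMap ℚ (PadicAlgCl 2) (ratPlusSymbol f ((q : ℚ) * r * ((∏ v : S₀, Rat.HeightOneSpectrum.natGenerator (v : IsDedekindDomain.HeightOneSpectrum (NumberField.RingOfIntegers ℚ)) ^ (k v) : ℕ) : ℚ))) := by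
  obtain ⟨ha, hndvd⟩ := lFunction_eq_frobeniusTrace_of_forall_ne S₀ hSW hq hqS
  have h := heckeT_depletedCurveSymbol_localPolynomialAt hf S₀ hq hqS r
  have hq0 : (q : PadicAlgCl 2) ≠ 0 := by exact_mod_cast hq.ne_zero
  rw [if_neg hndvd, mul_inv_cancel₀ hq0, one_mul, ha] at h
  exact h

end Curve

end Summit.BirchSwinnertonDyer.BirchSwinnertonDyer.Theorems.ThetaLayerLambdaCongruenceAtTwo

end
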